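import Literature.NumberTheory.EllipticCurves.LocalTatePairingPoints
import Literature.NumberTheory.EllipticCurves.TateModuleBaseChange
import Literature.NumberTheory.EllipticCurves.GaloisActionProofs
import Literature.NumberTheory.EllipticCurves.SelmerProofs
import HarnessLib

/-!
# The `T`-adic Kummer cocycle of a rational point: existence, and its level classes are the Kummer classes `κ_{p^k}(P)`

Topic `NumberTheory/EllipticCurves`; namespace `Literature.NumberTheory.EllipticCurves`. THEOREMS ONLY (no definition, no named
fact, no instance, no `sorry`). Sequel of `LocalTatePairingPoints.lean` (the `ℤ_p`-valued local Tate pairing with points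
`tatePairingPoint`, built from the LEVEL Kummer classes `kummerLevelClass W F p k P = κ_{p^k}(P)`), closing the bookkeeping gap its
consumers leave open: `tatePairing_eq_tatePairingPoint`, `tatePairingPoint_eq_invPadic_cupProduct`
(`LocalTatePairingCupProductPadic`), the recognition socket `ReciprocityCalibrationSocket` and Kato's-formula capstones
`TatePairingPointOfTeichLogRecognition` / `TatePairingPointOfKTwo(Matching)` (crux K★ `stmt-BirchSwinnertonDyer-22226`, memo
`Summits/BirchSwinnertonDyer/BirchSwinnertonDyer/Cruxes/StarredOptimalManinUnitFiveSeven/Lines/kato-lever-K3-legendre.md` §4/§6 gap 2a)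
all take AS A HYPOTHESIS a class / continuous cocycle `y ∈ H¹(F, T_pW|_{Γ_F})` «all of whose projections are the level Kummer classes
of `P`». This file CONSTRUCTS it, for every `F`-rational point `P` of an elliptic curve `W/K₀` (`K₀ ⊆ F`, characteristic `0`):

* §1 `exists_divSeq` — a `p`-power DIVISION SEQUENCE `Q : ℕ → (W ×_{K₀} F)(F̄)` of `P` (`Q₀ = P`, `p • Q_{n+1} = Q_n`; divisibility of
  `E(F̄)`, tree `zsmul_geomPoints_surjective_holds`); `pow_smul_divSeq'`, `pow_smul_gal_sub_divSeq_eq_zero`, `smul_gal_sub_divSeq_succ`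
  (`(σQₙ − Qₙ)ₙ` is a compatible system of `pⁿ`-torsion points);
* §2 ★ `exists_contOneCocycles_tadicKummer` — the **`T`-adic Kummer cocycle** `κ_Q : σ ↦ θ_∞⁻¹((σQₙ − Qₙ)ₙ) ∈ Z¹_cont(Γ_F, T_pW|_{Γ_F})`,
  read in `T_pW` through the tree's restriction isomorphism `θ_∞ = tateModuleEquiv W F p : T_pW ⥲ T_p(W ×_{K₀} F)`
  (`TateModuleBaseChange`; equivariant along `absGaloisRestrict K₀ F`, bicontinuous): cocycle law from
  `(στ)Q − Q = (σQ − Q) + σ(τQ − Q)`, continuity from the open stabilisers of the `Qₙ` (`isOpen_stabilizer_point_holds`);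
* §3 ★★ `cohomologyMap_tateProjMor_oneCocycleClass_eq_kummerLevelClass` — **its level classes ARE the Kummer classes**:
  `pr_k [κ_Q] = kummerLevelClass W F p k P = κ_{p^k}(P)` for every `k` (`Q_k` is a `p^k`-th root of `P`; root-independence
  `kummerLevelClass_eq_localKummerClass`; comparison of cocycles on underlying points through the injective point map
  `geomPointsMapOfEmb W (closureEmb F) = localPointsEquivBaseChange ∘ pointsMap`);
* §4 ★★ `exists_tadicKummerClass` / `exists_contOneCocycles_forall_level_eq_kummerLevelClass` — **every `P ∈ E(F)` has a `T`-adic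
  Kummer class** `y ∈ H¹(F, T_pW|_{Γ_F})` with `pr_k y = κ_{p^k}(P)` for all `k` (the hypothesis `hy`/`hκ` of the consumers above), and
  the corollary `tatePairingPoint_eq_tatePairing_tadicKummer` (`⟨x, P⟩ = ⟨x, y⟩`).
* §5 `tatePairing_tadicKummer_eq_tatePairingPoint` — `⟨x, [κ_Q]⟩ = ⟨x, P⟩` (appended).

Mathematically this is the compatibility of the Kummer maps `E(F) → H¹(F, E[pⁿ])` in the tower (Silverman VIII §2) packaged as ONE
continuous cocycle with values in `T_pE = lim E[pⁿ]` (Bloch–Kato (3.11.1): `E(F) → H¹(F, T_pE)`); no new mathematics. BSD / K★ are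
not proved by any of this.

## References
* J. H. Silverman, *The Arithmetic of Elliptic Curves*, 2nd ed. (2009), VIII §2 (the Kummer pairing `κ(P, σ) = Q^σ − Q`,
  independence of `Q`), III §7 (the Tate module). [SilvermanAEC2009]
* S. Bloch, K. Kato, *L-functions and Tamagawa numbers of motives* (1990), (3.11.1) (`E(F) → H¹(F, T_pE)`). [BlochKato1990]
* J.-P. Serre, *Abelian ℓ-adic representations and elliptic curves* (1968), Ch. I §1.1–1.2. [Serre1968]
-/

noncomputable section

open scoped Classical

open CategoryTheory Function Field
open Literature.NumberTheory.GaloisRepresentations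
open Literature.NumberTheory.PAdicHodge (restrictedTateRep restrictedTateRep_apply_apply)

namespace Literature.NumberTheory.EllipticCurves

open _root_.WeierstrassCurve

-- universe-monomorphic, as `PAdicHodge.restrictedTateRep` / `LocalTatePairingPoints`
variable {K₀ : Type} [Field K₀] [CharZero K₀] (W : WeierstrassCurve K₀) [W.IsElliptic] (F : Type) [Field F]
  [Algebra K₀ F] (p : ℕ) [hp : Fact p.Prime]

/-! ### §1 Division sequences of a rational point -/

omit [CharZero K₀] in
/-- **Division sequences exist**: every `F`-rational point `P` of `W` has a `p`-power division sequence `Q` in `(W ×_{K₀} F)(F̄)`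
(`Q₀ = P`, `p • Q_{n+1} = Qₙ`), by the `p`-divisibility of `E(F̄)` (tree `zsmul_geomPoints_surjective_holds`).
[cite: SilvermanAEC2009, VIII §2] -/
theorem exists_divSeq (P : (W.baseChange F).toAffine.Point) :
    ∃ Q : ℕ → geomPoints (W.baseChange F), Q 0 = toGeomPoints (W.baseChange F) P ∧ ∀ n, p • Q (n + 1) = Q n := by
  have hdiv : ∀ R : geomPoints (W.baseChange F), ∃ S : geomPoints (W.baseChange F), p • S = R := fun R => by
    obtain ⟨S, hS⟩ := (W.baseChange F).zsmul_geomPoints_surjective_holds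
      (show ((p : ℕ) : ℤ) ≠ 0 by exact_mod_cast hp.out.ne_zero) R
    exact ⟨S, by simpa only [natCast_zsmul] using hS⟩
  choose d hd using hdiv
  refine ⟨fun n => Nat.rec (toGeomPoints (W.baseChange F) P) (fun _ R => d R) n, rfl, fun n => ?_⟩
  exact hd _

omit [CharZero K₀] [W.IsElliptic] hp in
/-- `pⁿ • Qₙ = Q₀` along a division sequence. [cite: SilvermanAEC2009, VIII §2] -/
theorem pow_smul_divSeq' {Q : ℕ → geomPoints (W.baseChange F)} (hQ : ∀ n, p • Q (n + 1) = Q n) (n : ℕ) :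
    p ^ n • Q n = Q 0 := by
  induction n with
  | zero => rw [pow_zero, one_smul]
  | succ n ih => rw [pow_succ, mul_smul, hQ, ih]

omit [CharZero K₀] [W.IsElliptic] hp in
/-- `pⁿ • (σQₙ − Qₙ) = σQ₀ − Q₀ = 0` for a division sequence with `Γ_F`-fixed base. [cite: SilvermanAEC2009, VIII §2] -/
theorem pow_smul_gal_sub_divSeq_eq_zero {Q : ℕ → geomPoints (W.baseChange F)} (hQ : ∀ n, p • Q (n + 1) = Q n)
    (hfix : ∀ σ : absoluteGaloisGroup F, σ • Q 0 = Q 0) (σ : absoluteGaloisGroup F) (n : ℕ) :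
    p ^ n • (σ • Q n - Q n) = 0 := by
  have h : p ^ n • (σ • Q n) = σ • (p ^ n • Q n) := (smul_comm σ (p ^ n) (Q n)).symm
  rw [smul_sub, h, pow_smul_divSeq' W F p hQ, hfix, sub_self]

omit [CharZero K₀] [W.IsElliptic] hp in
/-- `p • (σQ_{n+1} − Q_{n+1}) = σQₙ − Qₙ`. [cite: SilvermanAEC2009, VIII §2] -/
theorem smul_gal_sub_divSeq_succ {Q : ℕ → geomPoints (W.baseChange F)} (hQ : ∀ n, p • Q (n + 1) = Q n)
    (σ : absoluteGaloisGroup F) (n : ℕ) : p • (σ • Q (n + 1) - Q (n + 1)) = σ • Q n - Q n := by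
  have h : p • (σ • Q (n + 1)) = σ • (p • Q (n + 1)) := (smul_comm σ p (Q (n + 1))).symm
  rw [smul_sub, h, hQ]

omit [CharZero K₀] [W.IsElliptic] hp in
/-- The base of a division sequence of a RATIONAL point is `Γ_F`-fixed. [cite: SilvermanAEC2009, VIII §1] -/
theorem gal_smul_divSeq_zero {Q : ℕ → geomPoints (W.baseChange F)} {P : (W.baseChange F).toAffine.Point}
    (hQ0 : Q 0 = toGeomPoints (W.baseChange F) P) (σ : absoluteGaloisGroup F) : σ • Q 0 = Q 0 := by
  rw [hQ0, smul_toGeomPoints]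

/-! ### §2 The `T`-adic Kummer cocycle -/

omit [CharZero K₀] [W.IsElliptic] hp in
/-- The algebraic Kummer element `(σQₙ − Qₙ)ₙ ∈ T_p(W ×_{K₀} F)` satisfies the cocycle law for the action of `Γ_F`:
`((στ)Qₙ − Qₙ)ₙ = (σQₙ − Qₙ)ₙ + σ • (τQₙ − Qₙ)ₙ`. [cite: SilvermanAEC2009, VIII §2] -/
theorem tadicKummerElt_mul {Q : ℕ → geomPoints (W.baseChange F)} (hQ : ∀ n, p • Q (n + 1) = Q n)
    (hfix : ∀ σ : absoluteGaloisGroup F, σ • Q 0 = Q 0) (σ τ : absoluteGaloisGroup F) :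
    TateModule.mk (fun n => (σ * τ) • Q n - Q n) (pow_smul_gal_sub_divSeq_eq_zero W F p hQ hfix (σ * τ))
        (smul_gal_sub_divSeq_succ W F p hQ (σ * τ)) =
      TateModule.mk (fun n => σ • Q n - Q n) (pow_smul_gal_sub_divSeq_eq_zero W F p hQ hfix σ)
          (smul_gal_sub_divSeq_succ W F p hQ σ) +
        σ • TateModule.mk (fun n => τ • Q n - Q n) (pow_smul_gal_sub_divSeq_eq_zero W F p hQ hfix τ)
          (smul_gal_sub_divSeq_succ W F p hQ τ) := by
  refine TateModule.ext fun n => ?_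
  rw [map_add, TateModule.proj_smul_of_distribMulAction, TateModule.proj_mk, TateModule.proj_mk, TateModule.proj_mk,
    mul_smul, smul_sub]
  abel

/-- ★ **The `T`-adic Kummer cocycle of a division sequence.** For a `p`-power division sequence `Q` in `(W ×_{K₀} F)(F̄)` with
`Γ_F`-fixed base there is a continuous crossed homomorphism `κ_Q ∈ Z¹_cont(Γ_F, T_pW|_{Γ_F})` with
`κ_Q(σ) = θ_∞⁻¹((σQₙ − Qₙ)ₙ)`, `θ_∞ = tateModuleEquiv W F p` the restriction isomorphism `T_pW ⥲ T_p(W ×_{K₀} F)`.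
[cite: SilvermanAEC2009, VIII §2] [cite: BlochKato1990, (3.11.1)] [cite: Serre1968, Ch. I §1.1–1.2] -/
theorem exists_contOneCocycles_tadicKummer {Q : ℕ → geomPoints (W.baseChange F)} (hQ : ∀ n, p • Q (n + 1) = Q n)
    (hfix : ∀ σ : absoluteGaloisGroup F, σ • Q 0 = Q 0) :
    ∃ κ : contOneCocycles (restrictedTateRep W F p).toTopRep, ∀ σ,
      κ.1 σ = (tateModuleEquiv W F p).symm
        (TateModule.mk (fun n => σ • Q n - Q n) (pow_smul_gal_sub_divSeq_eq_zero W F p hQ hfix σ)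
          (smul_gal_sub_divSeq_succ W F p hQ σ)) := by
  -- continuity: the levels `σ ↦ σQₙ − Qₙ` are continuous into the discrete `E(F̄)` (open stabilisers), `θ_∞⁻¹` is continuous
  have hcont : Continuous fun σ : absoluteGaloisGroup F => (tateModuleEquiv W F p).symm
      (TateModule.mk (fun n => σ • Q n - Q n) (pow_smul_gal_sub_divSeq_eq_zero W F p hQ hfix σ)
        (smul_gal_sub_divSeq_succ W F p hQ σ)) := by
    refine (continuous_tateModuleEquiv_symm W F p).comp (TateModule.continuous_of_proj fun n => ?_)
    simp only [TateModule.proj_mk]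
    exact (continuous_smul_of_isOpen_stabilizer (Q n) (isOpen_stabilizer_point_holds (W.baseChange F) (Q n))).sub
      continuous_const
  refine ⟨⟨⟨_, hcont⟩, fun g h => ?_⟩, fun σ => rfl⟩
  change (tateModuleEquiv W F p).symm _ = (tateModuleEquiv W F p).symm _ + restrictedTateRep W F p g ((tateModuleEquiv W F p).symm _)
  rw [tadicKummerElt_mul W F p hQ hfix, map_add, tateModuleEquiv_symm_smul, restrictedTateRep_apply_apply]

/-! ### §3 The level classes are the Kummer classes -/

/-- `p^k ≠ 0` in `ℤ`. [folklore] -/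
private theorem pow_ne_zero_int' (k : ℕ) : ((p ^ k : ℕ) : ℤ) ≠ 0 := by
  exact_mod_cast pow_ne_zero k hp.out.ne_zero

/-- ★★ **The level classes of the `T`-adic Kummer cocycle are the Kummer classes of the point.** For a division sequence `Q` of the
`F`-rational point `P` (`Q₀ = P`) and any continuous cocycle `κ` with `κ(σ) = θ_∞⁻¹((σQₙ − Qₙ)ₙ)`:
`pr_k [κ] = kummerLevelClass W F p k P = κ_{p^k}(P)` for every `k` — `Q_k` is a `p^k`-th root of `P` and `κ_{p^k}(P)` is the class of
`σ ↦ σQ_k − Q_k` for ANY such root (`kummerLevelClass_eq_localKummerClass`). [cite: SilvermanAEC2009, VIII §2] [cite: BlochKato1990, (3.11.1)] -/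
theorem cohomologyMap_tateProjMor_oneCocycleClass_eq_kummerLevelClass {Q : ℕ → geomPoints (W.baseChange F)}
    (hQ : ∀ n, p • Q (n + 1) = Q n) {P : (W.baseChange F).toAffine.Point} (hQ0 : Q 0 = toGeomPoints (W.baseChange F) P)
    (κ : contOneCocycles (restrictedTateRep W F p).toTopRep)
    (hκ : ∀ σ, κ.1 σ = (tateModuleEquiv W F p).symm
      (TateModule.mk (fun n => σ • Q n - Q n) (pow_smul_gal_sub_divSeq_eq_zero W F p hQ (gal_smul_divSeq_zero W F hQ0) σ)
        (smul_gal_sub_divSeq_succ W F p hQ σ)))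
    (k : ℕ) :
    (cohomologyMap (tateProjMor W F p k) 1).hom (oneCocycleClass _ κ) = kummerLevelClass W F p k P := by
  -- `Q_k`, read in `E(K̄_F) = localPoints W F`, is a `p^k`-th root of `P`
  have hroot : ((p ^ k : ℕ) : ℤ) • W.baseChangeGeomPointsEquiv F (Q k) =
      W.baseChangeGeomPointsEquiv F (toGeomPoints (W.baseChange F) P) := by
    rw [← map_zsmul, natCast_zsmul, pow_smul_divSeq' W F p hQ k, hQ0]
  rw [kummerLevelClass_eq_localKummerClass W F p k P _ hroot, WeierstrassCurve.localKummerClass,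
    cohomologyMap_oneCocycleClass]
  refine congrArg (oneCocycleClass _) (Subtype.ext (ContinuousMap.ext fun σ => ?_))
  rw [pullback_id_resIdHom_apply, tateProjMor_hom_apply]
  -- compare the two `p^k`-torsion points after the injective point map `E(K̄₀) → (W ×_{K₀} F)(K̄_F)`
  apply Subtype.ext
  apply geomPointsMapOfEmb_injective W (closureEmb (K := K₀) F)
  change geomPointsMapOfEmb W (closureEmb (K := K₀) F) (TateModule.proj p k (κ.1 σ)) =
    localPointsEquivBaseChange W F (pointsMap W F ((W.localKummerCocycle _ (pow_ne_zero_int' p k)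
      (W.baseChangeGeomPointsEquiv F (Q k)) (W.zsmul_mem_fixedPoints_of_eq F hroot)).1 σ :
        geomTorsion W ((p ^ k : ℕ) : ℤ)))
  rw [hκ, tateModuleEquiv_eq, geomPointsMapOfEmb_proj_tateModuleEquivOfEmb_symm, TateModule.proj_mk,
    WeierstrassCurve.pointsMap_localKummerCocycle_apply, map_sub, localPointsEquivBaseChange_smul]
  rfl

/-! ### §4 Every rational point has a `T`-adic Kummer class -/

/-- ★★ **Every `F`-rational point has a `T`-adic Kummer cocycle**: for every `P ∈ E(F)` there is a continuous crossed homomorphism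
`κ ∈ Z¹_cont(Γ_F, T_pW|_{Γ_F})` all of whose level classes are the Kummer classes of `P`: `pr_k [κ] = κ_{p^k}(P)` for all `k`
(the hypothesis `hκ` of `TatePairingPointOfKTwo(Matching)` / `TatePairingPointOfTeichLogRecognition` / `ReciprocityCalibrationSocket`).
[cite: SilvermanAEC2009, VIII §2] [cite: BlochKato1990, (3.11.1)] -/
theorem exists_contOneCocycles_forall_level_eq_kummerLevelClass (P : (W.baseChange F).toAffine.Point) :
    ∃ κ : contOneCocycles (restrictedTateRep W F p).toTopRep,
      ∀ k, (cohomologyMap (tateProjMor W F p k) 1).hom (oneCocycleClass _ κ) = kummerLevelClass W F p k P := by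
  obtain ⟨Q, hQ0, hQ⟩ := exists_divSeq W F p P
  obtain ⟨κ, hκ⟩ := exists_contOneCocycles_tadicKummer W F p hQ (gal_smul_divSeq_zero W F hQ0)
  exact ⟨κ, cohomologyMap_tateProjMor_oneCocycleClass_eq_kummerLevelClass W F p hQ hQ0 κ hκ⟩

/-- ★★ **Every `F`-rational point has a `T`-adic Kummer class** `y ∈ H¹(F, T_pW|_{Γ_F})` with `pr_k y = κ_{p^k}(P)` for all `k`
(the hypothesis `hy` of `tatePairing_eq_tatePairingPoint` / `tatePairingPoint_eq_invPadic_cupProduct`). [cite: BlochKato1990, (3.11.1)]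
[cite: SilvermanAEC2009, VIII §2] -/
theorem exists_tadicKummerClass (P : (W.baseChange F).toAffine.Point) :
    ∃ y : continuousCohomology 1 (restrictedTateRep W F p).toTopRep,
      ∀ k, (cohomologyMap (tateProjMor W F p k) 1).hom y = kummerLevelClass W F p k P := by
  obtain ⟨κ, hκ⟩ := exists_contOneCocycles_forall_level_eq_kummerLevelClass W F p P
  exact ⟨oneCocycleClass _ κ, hκ⟩

/-! ### §5 The pairing with the `T`-adic Kummer class is the pairing with the point -/

/-- **`⟨x, [κ_Q]⟩ = ⟨x, P⟩`**: for a division sequence `Q` of `P` and its `T`-adic Kummer cocycle `κ_Q` (§2), the tree's `ℤ_p`-valued local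
Tate pairing of `x` with the CLASS `[κ_Q]` (`tatePairing`) is its pairing with the POINT `P` (`tatePairingPoint`), over any
non-archimedean local field `F` of characteristic `0` and every level-compatible Weil tower `e` (`tatePairing_eq_tatePairingPoint` + §3).
[cite: NeukirchSchmidtWingberg2008, (7.2.6)] [cite: BlochKato1990, Prop. 3.8 (p. 354)] -/
theorem tatePairing_tadicKummer_eq_tatePairingPoint [ValuativeRel F] [TopologicalSpace F] [IsNonarchimedeanLocalField F] [CharZero F]
    (e : (k : ℕ) → geomTorsion W ((p ^ k : ℕ) : ℤ) → geomTorsion W ((p ^ k : ℕ) : ℤ) → AlgebraicClosure K₀)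
    (hμ : ∀ k S T, e k S T ^ (p ^ k) = 1) (hadd₁ : ∀ k S₁ S₂ T, e k (S₁ + S₂) T = e k S₁ T * e k S₂ T)
    (hadd₂ : ∀ k S T₁ T₂, e k S (T₁ + T₂) = e k S T₁ * e k S T₂)
    (hgal : ∀ k (σ : absoluteGaloisGroup K₀) (S T : geomTorsion W ((p ^ k : ℕ) : ℤ)), σ • e k S T = e k (σ • S) (σ • T))
    (hcompat : ∀ k (S T : geomTorsion W ((p ^ (k + 1) : ℕ) : ℤ)),
      e k (torsionMulHom W (p ^ (k + 1)) (p ^ k) p (pow_succ p k).symm S)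
        (torsionMulHom W (p ^ (k + 1)) (p ^ k) p (pow_succ p k).symm T) = e (k + 1) S T ^ p)
    {Q : ℕ → geomPoints (W.baseChange F)} (hQ : ∀ n, p • Q (n + 1) = Q n) {P : (W.baseChange F).toAffine.Point}
    (hQ0 : Q 0 = toGeomPoints (W.baseChange F) P) (κ : contOneCocycles (restrictedTateRep W F p).toTopRep)
    (hκ : ∀ σ, κ.1 σ = (tateModuleEquiv W F p).symm
      (TateModule.mk (fun n => σ • Q n - Q n) (pow_smul_gal_sub_divSeq_eq_zero W F p hQ (gal_smul_divSeq_zero W F hQ0) σ)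
        (smul_gal_sub_divSeq_succ W F p hQ σ)))
    (x : continuousCohomology 1 (restrictedTateRep W F p).toTopRep) :
    tatePairing W F p e hμ hadd₁ hadd₂ hgal hcompat x (oneCocycleClass _ κ) = tatePairingPoint W F p e hμ hadd₁ hadd₂ hgal hcompat x P :=
  tatePairing_eq_tatePairingPoint W F p e hμ hadd₁ hadd₂ hgal hcompat x _ P
    (cohomologyMap_tateProjMor_oneCocycleClass_eq_kummerLevelClass W F p hQ hQ0 κ hκ)

end Literature.NumberTheory.EllipticCurves

end
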